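import Literature.AlgebraicGeometry.GroupSchemes.ConstantGroupScheme
import Literature.AlgebraicGeometry.GroupSchemes.UnitComponentClopen
import HarnessLib

/-!
# A finite subgroup of sections meeting the unit component trivially is the group of sections of a finite ÉTALE closed
# subgroup scheme, and reduction is injective on it ([SerreTate1968] §1; [Tate1997FiniteFlatGroupSchemes] (3.7))

Topic `Literature/AlgebraicGeometry/GroupSchemes`; namespace `Literature.AlgebraicGeometry.GroupSchemes.ConstantSubgroupOfSections`.
DEFINITIONS (`counit`, `sectionsRingHom`, `emb`) + theorems; no instance, no notation, no named fact, no `sorry`.  Cell `hodgecm-mathlib`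
(D-0151), FLOOR 0, P6 «MOD programme», sub-line `Cruxes/HLiu418/Lines/F0_P6b_ConnectedEtale.lean` ED. 2 (F0P6b-plan (g0)), stub
**`stub_b4g_etaleClosureOfGenericSubgroup_henselian`**, road σ1 «CLOPEN ∕ CONSTANT-SUBSCHEME currency» (F0P6-p13), file 2 of 2 over ★
`GroupSchemes/ConstantGroupScheme` and ★ `GroupSchemes/UnitComponentClopen`.  `--supports stmt-HodgeConjecture-24832`; count-neutral:
HC_CM is proved only modulo the printed citations until rung 0 closes, and nothing here bears on it.

THE PRINT.  [SerreTate1968] §1 (Lemma 1 and its use): over a henselian (there: complete) local base the reduction map on the points of a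
finite (flat) group scheme is injective on the prime-to-`G⁰` part and a subgroup of sections missing the connected component is «étale»;
[Tate1997FiniteFlatGroupSchemes] (3.7): constant∕étale finite group schemes and `G⁰`.  HEART use ([h4] of door P″): the `q` generic lines
`C_β ≠ C_can` of `E[𝔴]` have ÉTALE closures.

THE STATEMENT PROVED (`exists_etale_subgroup_of_sections` = the stub with `IsUnitComponent` unfolded, and with `HenselianLocalRing R`
WEAKENED to `IsLocalRing R` — the unit component being GIVEN, henselianity is not needed): `R` local, `G` a group object of `Over (Spec R)`
with `G → Spec R` finite, `j : G₀ ⟶ G` a homomorphism that is an open and closed immersion (a unit component), `C` a finite subgroup of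
the sections `𝟙_ ⟶ G` such that a member of `C` factoring through `j` is trivial.  THEN (i) two members of `C` with the same reduction
`Spec κ(R) → G` are equal, and (ii) there is a group object `C̄` with a homomorphism `c : C̄ ⟶ G` which is a CLOSED IMMERSION, `C̄ → Spec R`
FINITE ÉTALE, whose sections are exactly `C`.

THE ROAD.  (i) §3: for `s₁, s₂ ∈ C` with equal reductions, `s := s₁ s₂⁻¹ ∈ C` reduces to the unit point, hence its image meets the
CLOPEN `range j` through which `η` factors (`η ≫ j = η`); `Spec R` is connected, so `s` lands in `range j` (★ `UnitComponentClopen.range_subset_of_isClopen`)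
and factors through the open immersion `j` (Mathlib `IsOpenImmersion.lift`), so `s = 1`.  (ii) `C̄ := Spec (R^C)` (★ `constOver`),
`c := Spec` of `sectionsRingHom : Γ(G, 𝒪) → R^C`, `b ↦ (s♯ b)_{s ∈ C}` (§1; `σ_s ≫ c = s`, `constSection_comp_emb`).  §2: by (i) distinct
members have distinct reductions, hence — two sections of an affine `R`-scheme with the same closed point have the same reduction
(`residue_comp_counit_eq_of_comap_eq`, `specMap_residue_comp_left_eq`) and the kernel of `s♯` lies in the single maximal ideal
`(s♯)⁻¹𝔪_R` (`eq_comap_maximalIdeal_of_ker_le`) — pairwise COMAXIMAL kernels (`isCoprime_ker_counit`), so `sectionsRingHom` is surjective by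
the Chinese remainder theorem (Mathlib `Ideal.quotientInfToPiQuotient_surj`) and `c` is a closed immersion (Mathlib
`IsClosedImmersion.spec_of_surjective`).  §4: `c` intertwines ★ `mulLift`∕`constSection 1`∕`invLift` with `μ`∕`η`∕`ι` (checked on the
clopen points, ★ `hom_ext_constOver(_tensor)`), so ★ `exists_grpObj_isMonHom_of_lifts` makes `C̄` a group object and `c` a homomorphism;
sections of `C̄` are the `σ_s` (★ `exists_eq_constSection`, `R` local), i.e. exactly `C`; finite étale by ★ `isFinite_constOver_hom`,
`etale_constOver_hom`.  NOTE (for the card): the image of a single section need not be open (`μ_p × ℤ⧸p` over `ℤ_p[ζ_p]`,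
`C = {(ζ^i, i)}`), so `C̄` is built from the disjoint sections, not as a union of clopen pieces of `G`.

## References
* [SerreTate1968] J.-P. Serre, J. Tate, *Good reduction of abelian varieties*, Ann. of Math. 88 (1968), §1 (Lemma 1).
* [Tate1997FiniteFlatGroupSchemes] J. Tate, *Finite flat group schemes*, in: Cornell–Silverman–Stevens (eds.), *Modular Forms and Fermat's Last
  Theorem* (Springer 1997), (3.7).
* [StacksProject] The Stacks Project, Tag 00DT (Chinese remainder), Tag 04GG.
-/

noncomputable section

set_option backward.isDefEq.respectTransparency false

universe u

open CategoryTheory CategoryTheory.Limits AlgebraicGeometry MonoidalCategory CartesianMonoidalCategory TensorProduct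
open scoped MonObj

namespace Literature.AlgebraicGeometry.GroupSchemes.ConstantSubgroupOfSections

open ConstantGroupScheme

/-! ## §1 The counits of the sections and the embedding `Spec (R^C) → G` -/

section Emb

variable {R : Type u} [CommRing R] (G : Over (Spec (.of R))) [GrpObj G]

/-- **The counit `s♯ : Γ(G, 𝒪_G) → R` of a section `s : Spec R → G` over `Spec R`** (global sections of `s`, through `Γ(Spec R) ≅ R`).
[cite: Tate1997FiniteFlatGroupSchemes, (3.7)] -/
def counit (s : 𝟙_ (Over (Spec (.of R))) ⟶ G) : Γ(G.left, ⊤) →+* R :=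
  (((s.left : Spec (.of R) ⟶ G.left)).appTop ≫ (Scheme.ΓSpecIso (.of R)).hom).hom

omit [GrpObj G] in
/-- The counit of a section is a retraction of the structure map `R → Γ(G, 𝒪_G)`. [cite: Tate1997FiniteFlatGroupSchemes, (3.7)] -/
theorem counit_structureMap (s : 𝟙_ (Over (Spec (.of R))) ⟶ G) (r : R) :
    counit G s (((Scheme.ΓSpecIso (.of R)).inv ≫ G.hom.appTop) r) = r := by
  have hcomp : G.hom.appTop ≫ (s.left : Spec (.of R) ⟶ G.left).appTop = 𝟙 _ := by
    rw [← Scheme.Hom.comp_appTop, Over.w s]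
    exact Scheme.Hom.id_appTop
  change (((Scheme.ΓSpecIso (.of R)).inv ≫ G.hom.appTop) ≫ (s.left : Spec (.of R) ⟶ G.left).appTop ≫
    (Scheme.ΓSpecIso (.of R)).hom) r = r
  rw [Category.assoc, ← Category.assoc G.hom.appTop, hcomp, Category.id_comp, Iso.inv_hom_id]
  rfl

omit [GrpObj G] in
/-- The counit of a section is surjective. [cite: Tate1997FiniteFlatGroupSchemes, (3.7)] -/
theorem counit_surjective (s : 𝟙_ (Over (Spec (.of R))) ⟶ G) : Function.Surjective (counit G s) :=
  fun r => ⟨_, counit_structureMap G s r⟩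

variable (C : Subgroup (𝟙_ (Over (Spec (.of R))) ⟶ G))

/-- **`Γ(G, 𝒪_G) → R^C`, `b ↦ (s♯ b)_{s ∈ C}`**: the ring map whose `Spec` collects the sections `s ∈ C`. [cite: SerreTate1968, §1] -/
def sectionsRingHom : Γ(G.left, ⊤) →+* (↥C → R) :=
  RingHom.pi fun s => counit G s.1

/-- The `s`-component of `sectionsRingHom` is the counit of `s`. [cite: SerreTate1968, §1] -/
theorem evalRingHom_comp_sectionsRingHom (s : ↥C) :
    (Pi.evalRingHom (fun _ : ↥C => R) s).comp (sectionsRingHom G C) = counit G s.1 := rfl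

variable [IsAffine G.left]

/-- **The embedding `c : C_R = Spec (R^C) → G` of the constant scheme on a finite set `C` of sections** (`G` affine over `Spec R`):
`Spec (sectionsRingHom) ≫ (G ≅ Spec Γ(G, 𝒪_G))⁻¹`, a morphism over `Spec R` because every `s♯` is a retraction of the structure map.
[cite: SerreTate1968, §1] [cite: Tate1997FiniteFlatGroupSchemes, (3.7)] -/
def emb : constOver R ↥C ⟶ G :=
  Over.homMk (Spec.map (CommRingCat.ofHom (sectionsRingHom G C)) ≫ G.left.isoSpec.inv) (by
    have key : G.left.isoSpec.inv ≫ G.hom = Spec.map ((Scheme.ΓSpecIso (.of R)).inv ≫ G.hom.appTop) := by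
      rw [Spec.map_comp, ← Scheme.isoSpec_Spec_inv, Scheme.isoSpec_inv_naturality]
    rw [Category.assoc, key, ← Spec.map_comp]
    change _ = Spec.map (CommRingCat.ofHom (algebraMap R (↥C → R)))
    congr 1
    apply CommRingCat.hom_ext
    apply RingHom.ext
    intro r
    funext s
    exact counit_structureMap G s.1 r)

/-- The underlying morphism of `emb`. [cite: SerreTate1968, §1] -/
theorem emb_left : (emb G C).left = Spec.map (CommRingCat.ofHom (sectionsRingHom G C)) ≫ G.left.isoSpec.inv := rfl

/-- **The tautological section at `s ∈ C` embeds to `s`**: `σ_s ≫ c = s` (Mathlib `Scheme.isoSpec_inv_naturality`). [cite: SerreTate1968, §1] -/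
theorem constSection_comp_emb (s : ↥C) : constSection R s ≫ emb G C = s.1 := by
  apply Over.OverMorphism.ext
  rw [Over.comp_left, constSection_left, emb_left, ← Spec.map_comp_assoc]
  have h1 : CommRingCat.ofHom (sectionsRingHom G C) ≫ CommRingCat.ofHom (Pi.evalRingHom (fun _ : ↥C => R) s) =
      (s.1.left : Spec (.of R) ⟶ G.left).appTop ≫ (Scheme.ΓSpecIso (.of R)).hom := by
    rw [← CommRingCat.ofHom_comp, evalRingHom_comp_sectionsRingHom]
    rfl
  haveI : IsAffine (𝟙_ (Over (Spec (CommRingCat.of R)))).left := inferInstanceAs (IsAffine (Spec (.of R)))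
  rw [h1, Spec.map_comp, Category.assoc, Scheme.isoSpec_inv_naturality (s.1.left : Spec (.of R) ⟶ G.left)]
  change Spec.map _ ≫ (Spec (CommRingCat.of R)).isoSpec.inv ≫ _ = _
  rw [Scheme.isoSpec_Spec_inv, ← Spec.map_comp_assoc, Iso.inv_hom_id, Spec.map_id, Category.id_comp]

end Emb

/-! ## §2 Distinct reductions ⇒ comaximal kernels ⇒ the embedding is a closed immersion -/

section Closed

variable {R : Type u} [CommRing R] [IsLocalRing R] (G : Over (Spec (.of R))) [GrpObj G]

open IsLocalRing

omit [GrpObj G] in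
/-- Over a LOCAL base the kernel of the counit of a section lies in exactly ONE maximal ideal of `Γ(G, 𝒪_G)`, namely `(s♯)⁻¹ 𝔪_R` (the closed
point of the section). [cite: SerreTate1968, §1] [cite: StacksProject, Tag 00DT] -/
theorem eq_comap_maximalIdeal_of_ker_le (s : 𝟙_ (Over (Spec (.of R))) ⟶ G) (𝔫 : Ideal Γ(G.left, ⊤)) [𝔫.IsMaximal]
    (h : RingHom.ker (counit G s) ≤ 𝔫) : 𝔫 = (maximalIdeal R).comap (counit G s) := by
  have hsurj := counit_surjective G s
  have hcm : (𝔫.map (counit G s)).comap (counit G s) = 𝔫 := by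
    rw [Ideal.comap_map_of_surjective _ hsurj, sup_eq_left]
    exact fun x hx => h hx
  rcases Ideal.map_eq_top_or_isMaximal_of_surjective (counit G s) hsurj ‹𝔫.IsMaximal› with htop | hmax
  · exact absurd (by rw [← hcm, htop, Ideal.comap_top]) ‹𝔫.IsMaximal›.ne_top
  · rw [← hcm, IsLocalRing.eq_maximalIdeal hmax]

omit [GrpObj G] in
/-- **Two sections with the same closed point have the same reduction** as ring maps `Γ(G, 𝒪_G) → κ(R)` (`b ≡ s♯(b)·1` modulo `ker s♯ ⊆ (t♯)⁻¹𝔪_R`).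
[cite: SerreTate1968, §1] -/
theorem residue_comp_counit_eq_of_comap_eq (s t : 𝟙_ (Over (Spec (.of R))) ⟶ G)
    (h : (maximalIdeal R).comap (counit G s) = (maximalIdeal R).comap (counit G t)) :
    (residue R).comp (counit G s) = (residue R).comp (counit G t) := by
  refine RingHom.ext fun b => ?_
  set r := counit G s b with hr
  have hb : b - ((Scheme.ΓSpecIso (.of R)).inv ≫ G.hom.appTop) r ∈ (maximalIdeal R).comap (counit G t) := by
    rw [← h, Ideal.mem_comap, map_sub, counit_structureMap, hr, sub_self]
    exact Ideal.zero_mem _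
  rw [Ideal.mem_comap, map_sub, counit_structureMap, ← Ideal.Quotient.eq] at hb
  rw [RingHom.comp_apply, RingHom.comp_apply]
  exact hb.symm

omit [GrpObj G] [IsLocalRing R] in
/-- The reduction `Spec κ(R) → Spec R →s G` of a section of an affine `G` is `Spec (residue ∘ s♯)` followed by `(G ≅ Spec Γ(G, 𝒪_G))⁻¹`.
[cite: SerreTate1968, §1] -/
theorem specMap_residue_comp_left_eq [IsLocalRing R] [IsAffine G.left] (s : 𝟙_ (Over (Spec (.of R))) ⟶ G) :
    Spec.map (CommRingCat.ofHom (residue R)) ≫ (s.left : Spec (.of R) ⟶ G.left) =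
      Spec.map (CommRingCat.ofHom ((residue R).comp (counit G s))) ≫ G.left.isoSpec.inv := by
  haveI : IsAffine (𝟙_ (Over (Spec (CommRingCat.of R)))).left := inferInstanceAs (IsAffine (Spec (.of R)))
  have h1 : CommRingCat.ofHom ((residue R).comp (counit G s)) =
      ((s.left : Spec (.of R) ⟶ G.left).appTop ≫ (Scheme.ΓSpecIso (.of R)).hom) ≫ CommRingCat.ofHom (residue R) := rfl
  rw [h1]
  simp only [Spec.map_comp, Category.assoc]
  rw [Scheme.isoSpec_inv_naturality (s.left : Spec (.of R) ⟶ G.left)]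
  change _ = _ ≫ _ ≫ (Spec (CommRingCat.of R)).isoSpec.inv ≫ _
  rw [Scheme.isoSpec_Spec_inv, ← Spec.map_comp_assoc (Scheme.ΓSpecIso (.of R)).inv (Scheme.ΓSpecIso (.of R)).hom,
    Iso.inv_hom_id, Spec.map_id, Category.id_comp]

omit [GrpObj G] in
/-- **Sections with DISTINCT reductions have COMAXIMAL counit kernels** (a maximal ideal containing both kernels would be the common closed
point, forcing equal reductions). [cite: SerreTate1968, §1] [cite: StacksProject, Tag 00DT] -/
theorem isCoprime_ker_counit [IsAffine G.left] (s t : 𝟙_ (Over (Spec (.of R))) ⟶ G)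
    (hst : Spec.map (CommRingCat.ofHom (residue R)) ≫ (s.left : Spec (.of R) ⟶ G.left) ≠
      Spec.map (CommRingCat.ofHom (residue R)) ≫ (t.left : Spec (.of R) ⟶ G.left)) :
    IsCoprime (RingHom.ker (counit G s)) (RingHom.ker (counit G t)) := by
  rw [Ideal.isCoprime_iff_sup_eq]
  by_contra hne
  obtain ⟨𝔫, h𝔫, hle⟩ := Ideal.exists_le_maximal _ hne
  haveI := h𝔫
  have hs := eq_comap_maximalIdeal_of_ker_le G s 𝔫 (le_sup_left.trans hle)
  have ht := eq_comap_maximalIdeal_of_ker_le G t 𝔫 (le_sup_right.trans hle)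
  apply hst
  rw [specMap_residue_comp_left_eq, specMap_residue_comp_left_eq,
    residue_comp_counit_eq_of_comap_eq G s t (hs.symm.trans ht)]

variable (C : Subgroup (𝟙_ (Over (Spec (.of R))) ⟶ G))

/-- **Chinese remainder**: for a finite set `C` of sections with pairwise distinct reductions, `Γ(G, 𝒪_G) → R^C`, `b ↦ (s♯ b)_s`, is
SURJECTIVE (Mathlib `Ideal.quotientInfToPiQuotient_surj` on the pairwise comaximal kernels). [cite: StacksProject, Tag 00DT] [cite: SerreTate1968, §1] -/
theorem surjective_sectionsRingHom [IsAffine G.left] (hC : (C : Set (𝟙_ (Over (Spec (.of R))) ⟶ G)).Finite)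
    (hinj : ∀ s t : ↥C, Spec.map (CommRingCat.ofHom (residue R)) ≫ (s.1.left : Spec (.of R) ⟶ G.left) =
      Spec.map (CommRingCat.ofHom (residue R)) ≫ (t.1.left : Spec (.of R) ⟶ G.left) → s = t) :
    Function.Surjective (sectionsRingHom G C) := by
  haveI : Finite ↥C := hC.to_subtype
  have hcop : Pairwise fun s t : ↥C => IsCoprime (RingHom.ker (counit G s.1)) (RingHom.ker (counit G t.1)) :=
    fun s t hst => isCoprime_ker_counit G s.1 t.1 fun h => hst (hinj s t h)
  intro g
  choose b hb using fun s : ↥C => counit_surjective G s.1 (g s)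
  obtain ⟨q, hq⟩ := Ideal.quotientInfToPiQuotient_surj (I := fun s : ↥C => RingHom.ker (counit G s.1)) hcop
    fun s => Ideal.Quotient.mk _ (b s)
  obtain ⟨x, rfl⟩ := Ideal.Quotient.mk_surjective q
  refine ⟨x, funext fun s => ?_⟩
  have hs := congrFun hq s
  rw [Ideal.quotientInfToPiQuotient_mk', Ideal.Quotient.eq, RingHom.mem_ker, map_sub, sub_eq_zero] at hs
  rw [← hb s, ← hs]
  rfl

/-- **The embedding of the constant scheme on sections with pairwise distinct reductions is a CLOSED IMMERSION** (`Spec` of a surjection,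
Mathlib `IsClosedImmersion.spec_of_surjective`). [cite: SerreTate1968, §1] [cite: Tate1997FiniteFlatGroupSchemes, (3.7)] -/
theorem isClosedImmersion_emb_left [IsAffine G.left] (hC : (C : Set (𝟙_ (Over (Spec (.of R))) ⟶ G)).Finite)
    (hinj : ∀ s t : ↥C, Spec.map (CommRingCat.ofHom (residue R)) ≫ (s.1.left : Spec (.of R) ⟶ G.left) =
      Spec.map (CommRingCat.ofHom (residue R)) ≫ (t.1.left : Spec (.of R) ⟶ G.left) → s = t) :
    IsClosedImmersion (emb G C).left := by
  rw [emb_left]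
  haveI := IsClosedImmersion.spec_of_surjective (CommRingCat.ofHom (sectionsRingHom G C))
    (surjective_sectionsRingHom G C hC hinj)
  infer_instance

end Closed

/-! ## §3 Reduction is injective on a subgroup of sections meeting the unit component trivially -/

section Reduction

variable {R : Type u} [CommRing R] [IsLocalRing R] {G G₀ : Over (Spec (.of R))} [GrpObj G] [GrpObj G₀] (j : G₀ ⟶ G)

open IsLocalRing

/-- **A section reducing to the unit point factors through any open-and-closed subgroup scheme** `j : G₀ ⟶ G` (a homomorphism whose
underlying morphism is an open and a closed immersion, e.g. the unit component): `Spec R` is connected (`R` local), its image meets the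
clopen `range j` (through which `η` factors, `η ≫ j = η`) at the closed point, hence lies in it (★ `UnitComponentClopen.range_subset_of_isClopen`),
and the section lifts through the open immersion (Mathlib `IsOpenImmersion.lift`). [cite: SerreTate1968, §1 (Lemma 1)]
[cite: Tate1997FiniteFlatGroupSchemes, (3.7)] -/
theorem exists_fac_of_reduction_eq_one [IsMonHom j] [IsOpenImmersion j.left] [IsClosedImmersion j.left]
    (s : 𝟙_ (Over (Spec (.of R))) ⟶ G)
    (hs : Spec.map (CommRingCat.ofHom (residue R)) ≫ (s.left : Spec (.of R) ⟶ G.left) =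
      Spec.map (CommRingCat.ofHom (residue R)) ≫ ((η[G]).left : Spec (.of R) ⟶ G.left)) :
    ∃ s₀ : 𝟙_ (Over (Spec (.of R))) ⟶ G₀, s₀ ≫ j = s := by
  haveI : ConnectedSpace ↥((𝟙_ (Over (Spec (CommRingCat.of R)))).left) :=
    Literature.AlgebraicGeometry.Morphisms.connectedSpace_Spec_of_isLocalRing R
  have hclopen : IsClopen (Set.range j.left) :=
    ⟨j.left.isClosedEmbedding.isClosed_range, j.left.isOpenEmbedding.isOpen_range⟩
  let x₀ : ↥(Spec (.of R)) := Spec.map (CommRingCat.ofHom (residue R)) (closedPoint (ResidueField R))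
  have hx₀ : (s.left : Spec (.of R) ⟶ G.left) x₀ ∈ Set.range j.left := by
    have h1 : (s.left : Spec (.of R) ⟶ G.left) x₀ = ((η[G]).left : Spec (.of R) ⟶ G.left) x₀ := by
      change (Spec.map (CommRingCat.ofHom (residue R)) ≫ (s.left : Spec (.of R) ⟶ G.left)) _ =
        (Spec.map (CommRingCat.ofHom (residue R)) ≫ ((η[G]).left : Spec (.of R) ⟶ G.left)) _
      rw [hs]
    rw [h1, ← IsMonHom.one_hom (f := j), Over.comp_left, Scheme.Hom.comp_apply]
    exact ⟨_, rfl⟩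
  have hsub : Set.range (s.left : Spec (.of R) ⟶ G.left) ⊆ Set.range j.left :=
    UnitComponentClopen.range_subset_of_isClopen _ hclopen x₀ hx₀
  refine ⟨Over.homMk (IsOpenImmersion.lift j.left (s.left : Spec (.of R) ⟶ G.left) hsub) ?_, ?_⟩
  · rw [← Over.w j, ← Category.assoc, IsOpenImmersion.lift_fac]
    exact Over.w s
  · ext : 1
    exact IsOpenImmersion.lift_fac _ _ _

/-- **Reduction is injective on a subgroup of sections meeting the open-and-closed subgroup `G₀` trivially** ([SerreTate1968] §1: the kernel of
reduction is `G⁰`): if `s₁, s₂ ∈ C` have the same `κ(R)`-point then `s₁ s₂⁻¹ ∈ C` reduces to the unit (precomposition with `Spec κ(R) → Spec R`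
is a group homomorphism, Mathlib `MonObj.comp_mul`, `GrpObj.comp_inv`), so it factors through `j` and is `1`. [cite: SerreTate1968, §1 (Lemma 1)]
[cite: Tate1997FiniteFlatGroupSchemes, (3.7)] -/
theorem eq_of_reduction_eq [IsMonHom j] [IsOpenImmersion j.left] [IsClosedImmersion j.left]
    (C : Subgroup (𝟙_ (Over (Spec (.of R))) ⟶ G))
    (hC0 : ∀ s ∈ C, (∃ s₀ : 𝟙_ (Over (Spec (.of R))) ⟶ G₀, s₀ ≫ j = s) → s = 1)
    {s₁ s₂ : 𝟙_ (Over (Spec (.of R))) ⟶ G} (h₁ : s₁ ∈ C) (h₂ : s₂ ∈ C)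
    (h : Spec.map (CommRingCat.ofHom (residue R)) ≫ (s₁.left : Spec (.of R) ⟶ G.left) =
      Spec.map (CommRingCat.ofHom (residue R)) ≫ (s₂.left : Spec (.of R) ⟶ G.left)) :
    s₁ = s₂ := by
  -- the `κ`-point as an object over `Spec R`
  let ρ : Over.mk (Spec.map (CommRingCat.ofHom (residue R))) ⟶ 𝟙_ (Over (Spec (.of R))) :=
    Over.homMk (Spec.map (CommRingCat.ofHom (residue R))) (Category.comp_id _)
  have hρ : ρ ≫ s₁ = ρ ≫ s₂ := Over.OverMorphism.ext h
  have hone : ρ ≫ (s₁ * s₂⁻¹) = ρ ≫ η[G] := by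
    rw [MonObj.comp_mul, GrpObj.comp_inv, hρ, mul_inv_cancel, CategoryTheory.Hom.one_def,
      CartesianMonoidalCategory.toUnit_unique (toUnit _) ρ]
  have hone' := congrArg (fun f => f.left) hone
  simp only [Over.comp_left, ρ, Over.homMk_left] at hone'
  obtain ⟨s₀, hs₀⟩ := exists_fac_of_reduction_eq_one j (s₁ * s₂⁻¹) hone'
  exact mul_inv_eq_one.mp (hC0 _ (C.mul_mem h₁ (C.inv_mem h₂)) ⟨s₀, hs₀⟩)

end Reduction

/-! ## §4 The subgroup scheme: group structure, sections, and the main theorem -/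

section Group

variable {R : Type u} [CommRing R] (G : Over (Spec (.of R))) [GrpObj G]
  (C : Subgroup (𝟙_ (Over (Spec (.of R))) ⟶ G)) [IsAffine G.left] [Fintype ↥C] [DecidableEq ↥C]

/-- **`μ` lifts**: `mulLift ≫ c = (c × c) ≫ μ_G` for a subGROUP `C` of sections — checked on the pairs of tautological sections (★
`hom_ext_constOver_tensor`), where both sides are `s · t` (★ `lift_constSection_comp_mulLift`, Mathlib `Hom.mul_def`). [cite: Tate1997FiniteFlatGroupSchemes, (3.7)] -/
theorem mulLift_comp_emb : mulLift R ↥C ≫ emb G C = (emb G C ⊗ₘ emb G C) ≫ μ[G] := by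
  apply Over.OverMorphism.ext
  refine hom_ext_constOver_tensor R _ _ fun s t => ?_
  rw [← Over.comp_left, ← Over.comp_left, ← Category.assoc, lift_constSection_comp_mulLift, constSection_comp_emb,
    CartesianMonoidalCategory.lift_map_assoc, constSection_comp_emb, constSection_comp_emb, Subgroup.coe_mul,
    CategoryTheory.Hom.mul_def]

omit [Fintype ↥C] [DecidableEq ↥C] in
/-- **`η` lifts**: the tautological section at `1 ∈ C` embeds to the unit `η_G`. [cite: Tate1997FiniteFlatGroupSchemes, (3.7)] -/
theorem constSection_one_comp_emb : constSection R (1 : ↥C) ≫ emb G C = η[G] := by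
  rw [constSection_comp_emb, Subgroup.coe_one, CategoryTheory.Hom.one_def, CartesianMonoidalCategory.toUnit_unit,
    Category.id_comp]

/-- **`ι` lifts**: `invLift ≫ c = c ≫ ι_G` for a subgroup `C` of sections (checked on the tautological sections, both sides `s⁻¹`). [cite: Tate1997FiniteFlatGroupSchemes, (3.7)] -/
theorem invLift_comp_emb : invLift R ↥C ≫ emb G C = emb G C ≫ ι[G] := by
  apply Over.OverMorphism.ext
  refine hom_ext_constOver R _ _ fun s => ?_
  rw [← Over.comp_left, ← Over.comp_left, ← Category.assoc, constSection_comp_invLift, constSection_comp_emb,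
    ← Category.assoc, constSection_comp_emb, Subgroup.coe_inv, CategoryTheory.Hom.inv_def]

/-- **The constant scheme on a finite subgroup `C` of sections is a subgroup scheme of `G` through `c`** whenever `c` is a monomorphism: a
group-object structure on `C_R` with `μ = mulLift`, `η = σ_1`, `ι = invLift` for which `c` is a homomorphism (★ `exists_grpObj_isMonHom_of_lifts`,
[SGA3] I 2.3.3 in the tree's form). [cite: Tate1997FiniteFlatGroupSchemes, (3.7)] [cite: SerreTate1968, §1] -/
theorem exists_grpObj_isMonHom_emb [Mono (emb G C)] :
    ∃ GC : GrpObj (constOver R ↥C), letI := GC; IsMonHom (emb G C) := by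
  obtain ⟨GC, -, -, -, h⟩ := exists_grpObj_isMonHom_of_lifts (emb G C) (mulLift R ↥C) (mulLift_comp_emb G C)
    (constSection R (1 : ↥C)) (constSection_one_comp_emb G C) (invLift R ↥C) (invLift_comp_emb G C)
  exact ⟨GC, h⟩

/-- **Over a LOCAL base the sections of `C_R` through `c` are exactly the members of `C`** (every section of `C_R` is tautological, ★
`exists_eq_constSection`). [cite: SerreTate1968, §1] [cite: Tate1997FiniteFlatGroupSchemes, (3.7)] -/
theorem mem_iff_exists_comp_emb [IsLocalRing R] (s : 𝟙_ (Over (Spec (.of R))) ⟶ G) :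
    s ∈ C ↔ ∃ sbar : 𝟙_ (Over (Spec (.of R))) ⟶ constOver R ↥C, sbar ≫ emb G C = s := by
  constructor
  · intro hs
    exact ⟨constSection R ⟨s, hs⟩, constSection_comp_emb G C ⟨s, hs⟩⟩
  · rintro ⟨sbar, rfl⟩
    obtain ⟨t, rfl⟩ := exists_eq_constSection R sbar
    rw [constSection_comp_emb]
    exact t.2

end Group

section Main

open IsLocalRing

/-- **A finite subgroup of sections meeting the unit component trivially: injective reduction and its ÉTALE closed subgroup scheme**
([SerreTate1968] §1) — the statement of stub `stub_b4g_etaleClosureOfGenericSubgroup_henselian` of `Lines/F0_P6b_ConnectedEtale.lean` ED. 2 with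
`IsUnitComponent G G₀ j` (`:= IsMonHom j ∧ IsOpenImmersion j.left ∧ IsClosedImmersion j.left ∧ ConnectedSpace G₀.left`) UNFOLDED binder for
binder and `HenselianLocalRing R` WEAKENED to `IsLocalRing R`.  Let `R` be local, `G` a group object of `Over (Spec R)` FINITE over `Spec R`,
`j : G₀ ⟶ G` a unit component, and `C` a finite subgroup of sections `𝟙_ ⟶ G` whose members factoring through `j` are trivial.  THEN (i) members
of `C` with the same reduction `Spec κ(R) → G` are equal (`eq_of_reduction_eq`); (ii) `C̄ := C_R = Spec (R^C)` with `c := emb` is a group object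
with `c` a homomorphism (`exists_grpObj_isMonHom_emb`), `c` a CLOSED IMMERSION (`isClosedImmersion_emb_left`, by (i)), `C̄ → Spec R` FINITE and
ÉTALE (★ `isFinite_constOver_hom`, `etale_constOver_hom`), and the sections of `C̄` are exactly `C` (`mem_iff_exists_comp_emb`).
[cite: SerreTate1968, §1 (Lemma 1)] [cite: Tate1997FiniteFlatGroupSchemes, (3.7)] -/
theorem exists_etale_subgroup_of_sections (R : Type u) [CommRing R] [IsLocalRing R] (G G₀ : Over (Spec (.of R)))
    [GrpObj G] [GrpObj G₀] (j : G₀ ⟶ G) (hG : IsFinite G.hom)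
    (hj : IsMonHom j ∧ IsOpenImmersion j.left ∧ IsClosedImmersion j.left ∧ ConnectedSpace ↥G₀.left)
    (C : Subgroup (𝟙_ (Over (Spec (.of R))) ⟶ G)) (hC : (C : Set (𝟙_ (Over (Spec (.of R))) ⟶ G)).Finite)
    (hC0 : ∀ s ∈ C, (∃ s₀ : 𝟙_ (Over (Spec (.of R))) ⟶ G₀, s₀ ≫ j = s) → s = 1) :
    (∀ s₁ ∈ C, ∀ s₂ ∈ C,
        Spec.map (CommRingCat.ofHom (residue R)) ≫ s₁.left = Spec.map (CommRingCat.ofHom (residue R)) ≫ s₂.left →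
          s₁ = s₂) ∧
    ∃ (Cbar : Over (Spec (.of R))) (_ : GrpObj Cbar) (c : Cbar ⟶ G),
      IsMonHom c ∧ IsClosedImmersion c.left ∧ IsFinite Cbar.hom ∧ Etale Cbar.hom ∧
        ∀ s : 𝟙_ (Over (Spec (.of R))) ⟶ G, s ∈ C ↔ ∃ sbar : 𝟙_ (Over (Spec (.of R))) ⟶ Cbar, sbar ≫ c = s := by
  classical
  obtain ⟨hjm, hjo, hjc, -⟩ := hj
  haveI := hjm
  haveI : IsAffine G.left := isAffine_of_isAffineHom G.hom
  haveI : Finite ↥C := hC.to_subtype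
  letI : Fintype ↥C := Fintype.ofFinite _
  -- (i) reduction is injective on `C`
  have hinj : ∀ s₁ ∈ C, ∀ s₂ ∈ C,
      Spec.map (CommRingCat.ofHom (residue R)) ≫ s₁.left = Spec.map (CommRingCat.ofHom (residue R)) ≫ s₂.left →
        s₁ = s₂ := fun s₁ h₁ s₂ h₂ h => eq_of_reduction_eq j C hC0 h₁ h₂ h
  refine ⟨hinj, ?_⟩
  -- (ii) the constant scheme `Spec (R^C)` embedded by the sections
  have hinj' : ∀ s t : ↥C, Spec.map (CommRingCat.ofHom (residue R)) ≫ (s.1.left : Spec (.of R) ⟶ G.left) =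
      Spec.map (CommRingCat.ofHom (residue R)) ≫ (t.1.left : Spec (.of R) ⟶ G.left) → s = t :=
    fun s t h => Subtype.ext (hinj s.1 s.2 t.1 t.2 h)
  haveI hcl : IsClosedImmersion (emb G C).left := isClosedImmersion_emb_left G C hC hinj'
  haveI : Mono (emb G C) := Over.mono_of_mono_left _
  obtain ⟨GC, hmon⟩ := exists_grpObj_isMonHom_emb G C
  exact ⟨constOver R ↥C, GC, emb G C, hmon, hcl, isFinite_constOver_hom R, etale_constOver_hom R,
    mem_iff_exists_comp_emb G C⟩

end Main

end Literature.AlgebraicGeometry.GroupSchemes.ConstantSubgroupOfSections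

end
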